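import Literature.NumberTheory.Sieve.ChenTwinSieveLower
import Literature.NumberTheory.Sieve.RosserSieveTheoremOneHalfLt
import Literature.NumberTheory.Sieve.LinearSieveConstant
import Literature.NumberTheory.Sieve.ParityBarrierLevelProofs
import Literature.NumberTheory.Sieve.JurkatRichertRefutation
import HarnessLib

/-!
# Chen's theorem: the lower bound for `S(A, 𝒫, z)` (Nathanson, Thm 10.4) — PROVED

Topic `Literature/NumberTheory/Sieve`; companion of `ChenTheorem.lean`, which vendors the
architecture of the printed proof of Chen's theorem `N = p + P₂` (Nathanson, *Additive Number
Theory: The Classical Bases*, GTM 164, Ch. 10) as named facts. This file DISCHARGES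
`Literature.NumberTheory.Sieve.Chen.chen_sifted_lower` (Thm 10.4): for every `ε > 0` and all large
even `N`, with `z = N^{1/8}`, `A = {N - p : p ≤ N prime, p ∤ N}`, `𝒫 = {p : p ∤ N}`,

  `S(A, 𝒫, z) > (e^γ log 3 / 2 - ε) · N V(z) / log N`,  `V(z) = ∏_{p < z, p ∤ N} (1 - 1/(p-1))`.

Everything here is proved (`chen_sifted_lower_holds`); the inputs are theorems of the tree.

## The printed proof (Nathanson pp. 171–172 of the held copy) and its formal counterpart

Nathanson applies the Jurkat–Richert theorem (Thm 9.7, with `f(s) = 2e^γ log(s-1)/s` on `[2, 4]`,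
Thm 9.8) to the sequence `A` with `g(d) = 1/φ(d)` (§10.3: (9.33) since `N` is even, (9.34) by
Mertens), `X = V(z)|A|`, `|A| = π(N) - ω(N) = (1 + O(1/log N)) N/log N` (prime number theorem),
remainders `r(d) = |A_d| - |A|/φ(d) = δ(N; d, N) + O(log N)` controlled on average over
`d < D = N^{1/2}(log N)^{-B-1}` by the Bombieri–Vinogradov theorem (`R ≪ N/(log N)³`), and
`s = log D/log z → 4`, `f(s) → f(4) = e^γ log 3/2`.

The formal proof follows this line with the tree's PROVED form of the linear sieve in place of the
(unproved, explicitly-constanted) transcription `LinearSieve.jurkatRichert_lower` of Thm 9.7: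

* `Literature.NumberTheory.Sieve.Iwaniec1980_thm1_lower_of_half_lt` (Iwaniec, *Rosser's sieve*,
  Acta Arith. 36 (1980), Thm 1, proved in `RosserSieveTheoremOneHalfLt.lean`) at `κ = 1`:
  uniformly in the sifted sequence `A` of dimension `Ω(1, L)`,
  `S(A, P(z); x) ≥ X V(z) (f(log y/log z) - C(L)(log y)^{-1/3}) - ∑_{d < y, d ∣ P(z)} |r_d(x)|`,
  where `f` is the lower function of the greatest `β`-data of dimension `1`, identified with
  `2e^γ log(s-1)/s` on `[2, 4]` by `IsGreatestBetaSieveData.eqOn_iwaniecSieveFun`,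
  `lowerSieveFun_one` and `lowerSieveFun_one_eq_holds` (`LinearSieveConstant.lean`);
* the Bombieri–Vinogradov theorem `BombieriVinogradovStatement_holds` (`ParityBarrierLevelProofs.lean`)
  in the `π`-form `Chen.eventually_sum_abs_primeCountingDisc_le` (level `N^{1/2-δ}`; the `ε`-loss in
  the level is harmless because `f` is continuous at `4`: we take `D = N^{1/2-δ}`, `s = 4 - 8δ`);
* the prime number theorem (`Chen.eventually_primeCounting_bounds`) and Mertens' product theorem
  with rate (`PairProducts.abs_log_mertensProd_sub_le`), which gives the dimension condition
  `Ω(1, L₀)` for `g` with an ABSOLUTE `L₀` (`hasIwaniecDimension_chenGoldbachSeq`), uniformly in even `N`.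

Dictionary (`chenGoldbachSeq N`): weights `a(n) = 1` iff `n < N`, `N - n` prime, `(N - n) ∤ N`
(i.e. `n ∈ A`); density `g = shiftedPrimesDensity N` (`g(d) = 1/φ(d)` for `(d, N) = 1`, else `0`);
size `X := π(N)` (instead of `|A| = π(N) - ω(N)`: the sieve theorem allows any `X ≥ 0`, and then
`|r(d)| ≤ |δ(N; d, N)| + ω(N)`, `abs_remainder_chenGoldbachSeq_le`). The sifting range is taken to be
ALL primes `< z` (`primesProdBelow z`): a prime `p ∣ N` has `g(p) = 0` and never divides an
element of `A`, so `S(A, P(z); N) = siftedCount N z` (`sifted_chenGoldbachSeq`) and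
`V(P(z)) = Chen.sieveProduct N z` (`densityProduct_chenGoldbachSeq`), exactly Nathanson's `S(A, 𝒫, z)`
and `V(z)` of (10.6), (10.8).

## References

* M. B. Nathanson, *Additive Number Theory: The Classical Bases*, GTM 164, Springer (1996),
  Thm 10.4 and its proof (PDF pp. 171–172 of the held copy), §10.3 (pp. 169–170). [Nathanson1996]
* H. Iwaniec, *Rosser's sieve*, Acta Arith. 36 (1980), 171–202, Theorem 1. [IwaniecActaArith1980]
* E. Bombieri, *On the large sieve*, Mathematika 12 (1965), 201–225. [Bombieri1965]
* G. H. Hardy, E. M. Wright, *An Introduction to the Theory of Numbers*, Thm 429 (Mertens). [HardyWright2008]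
-/

open Finset Filter Topology

noncomputable section

namespace Literature.NumberTheory.Sieve.Chen

open SieveSequence

/-! ### The Goldbach sifted sequence `A = {N - p}` -/

/-- The weights of Nathanson's sequence `A = {N - p : p ≤ N, p prime, p ∤ N}` (§10.2):
`a(n) = 1` if `n < N`, `N - n` is prime and `(N - n) ∤ N`, else `0`. [cite: Nathanson1996, (10.6)] -/
def chenGoldbachWeight (N n : ℕ) : ℝ :=
  if n < N ∧ (N - n).Prime ∧ ¬ (N - n) ∣ N then 1 else 0

/-- `0 ≤ a(n)`. [folklore] -/
theorem chenGoldbachWeight_nonneg (N n : ℕ) : 0 ≤ chenGoldbachWeight N n := by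
  unfold chenGoldbachWeight; split_ifs <;> norm_num

/-- **The Goldbach sifted sequence** for the even number `N` (Nathanson §10.2–10.4): weights
`a(n) = 1_A(n)`, density `g(d) = 1/φ(d)` for `(d, N) = 1` and `0` otherwise
(`Literature.NumberTheory.Sieve.shiftedPrimesDensity N`), size `X = π(N)` (constant in the height).
[cite: Nathanson1996, §10.3–10.4] -/
def chenGoldbachSeq (N : ℕ) : SieveSequence where
  a := chenGoldbachWeight N
  a_nonneg := chenGoldbachWeight_nonneg N
  size := fun _ => (Nat.primeCounting N : ℝ)
  density := shiftedPrimesDensity N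
  density_mult := isMultiplicative_shiftedPrimesDensity N

/-- Reindexing `n = N - p`: for every predicate `Q`,
`∑_{0 < n ≤ N, Q(n)} a(n) = #{(p, n) : p + n = N, p prime, p ∤ N, Q(n)}`. [folklore] -/
theorem sum_chenGoldbachWeight_filter (N : ℕ) (Q : ℕ → Prop) [DecidablePred Q] :
    ∑ n ∈ (Ioc 0 N).filter Q, chenGoldbachWeight N n =
      #{a ∈ antidiagonal N | a.1.Prime ∧ ¬ a.1 ∣ N ∧ Q a.2} := by
  classical
  have h1 : ∑ n ∈ (Ioc 0 N).filter Q, chenGoldbachWeight N n =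
      #{n ∈ (Ioc 0 N).filter Q | n < N ∧ (N - n).Prime ∧ ¬ (N - n) ∣ N} := by
    rw [Finset.natCast_card_filter]
    rfl
  rw [h1]
  norm_cast
  refine Finset.card_nbij' (fun n => (N - n, n)) (fun a => a.2) ?_ ?_ ?_ ?_
  · intro n hn
    simp only [mem_coe, mem_filter, mem_Ioc, HasAntidiagonal.mem_antidiagonal] at hn ⊢
    exact ⟨Nat.sub_add_cancel hn.1.1.2, hn.2.2.1, hn.2.2.2, hn.1.2⟩
  · intro a ha
    simp only [mem_coe, mem_filter, mem_Ioc, HasAntidiagonal.mem_antidiagonal] at ha ⊢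
    obtain ⟨hsum, hp, hndvd, hQ⟩ := ha
    have h2 : a.2 ≠ 0 := by
      intro h0
      apply hndvd
      rw [← hsum, h0, add_zero]
    have ha1 : N - a.2 = a.1 := by omega
    have hp2 := hp.two_le
    refine ⟨⟨⟨Nat.pos_of_ne_zero h2, by omega⟩, hQ⟩, by omega, ?_, ?_⟩
    · rw [ha1]; exact hp
    · rw [ha1]; exact hndvd
  · intro n _
    rfl
  · intro a ha
    simp only [mem_coe, mem_filter, HasAntidiagonal.mem_antidiagonal] at ha
    ext
    · show N - a.2 = a.1
      omega
    · rfl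

/-- **`S(A, P(z); N) = S(A, 𝒫, z)`**: sifting `A` by all primes `< z` counts the pairs
`(p, n)`, `p + n = N`, `p` prime, `p ∤ N`, with `n` free of prime factors `q < z`, `q ∤ N`
(a prime `q ∣ N` dividing `n = N - p` would divide `p`). [cite: Nathanson1996, (10.6)] -/
theorem sifted_chenGoldbachSeq (N : ℕ) (z : ℝ) :
    (chenGoldbachSeq N).sifted N (primesProdBelow z) = siftedCount N z := by
  classical
  rw [SieveSequence.sifted, Nat.floor_natCast]
  change ∑ n ∈ (Ioc 0 N).filter (fun n : ℕ => n.Coprime (primesProdBelow z)), chenGoldbachWeight N n = _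
  rw [sum_chenGoldbachWeight_filter, siftedCount]
  norm_cast
  refine congrArg Finset.card (Finset.ext fun a => ?_)
  simp only [Finset.mem_filter, HasAntidiagonal.mem_antidiagonal]
  constructor
  · rintro ⟨hsum, hp, hndvd, hcop⟩
    exact ⟨hsum, hp, hndvd, fun q hq _ => (coprime_primesProdBelow_iff _ _).mp hcop q hq⟩
  · rintro ⟨hsum, hp, hndvd, hq⟩
    refine ⟨hsum, hp, hndvd, (coprime_primesProdBelow_iff _ _).mpr fun q hqz hqdvd => ?_⟩
    have hqprime : q.Prime := Nat.prime_of_mem_primesBelow hqz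
    by_cases hqN : q ∣ N
    · -- `q ∣ N`, `q ∣ n` ⇒ `q ∣ p` ⇒ `q = p` ⇒ `p ∣ N`
      have hqp : q ∣ a.1 := by
        have : q ∣ a.1 + a.2 := by rw [hsum]; exact hqN
        exact (Nat.dvd_add_left hqdvd).mp this
      have := (Nat.prime_dvd_prime_iff_eq hqprime hp).mp hqp
      exact hndvd (this ▸ hqN)
    · exact hq q hqz hqN hqdvd

/-- **`V(P(z)) = V(z)`**: `∏_{p < z} (1 - g(p)) = ∏_{p < z, p ∤ N} (1 - 1/(p-1))`
(`g(p) = 1/(p-1)` for `p ∤ N`, `g(p) = 0` for `p ∣ N`). [cite: Nathanson1996, (10.8)] -/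
theorem densityProduct_chenGoldbachSeq (N : ℕ) (z : ℝ) :
    (chenGoldbachSeq N).densityProduct (primesProdBelow z) = sieveProduct N z := by
  rw [SieveSequence.densityProduct, primeFactors_primesProdBelow, sieveProduct, Finset.prod_filter]
  refine Finset.prod_congr rfl fun p hp => ?_
  have hp : p.Prime := Nat.prime_of_mem_primesBelow hp
  change 1 - shiftedPrimesDensity N p = _
  rw [shiftedPrimesDensity_apply]
  by_cases hdvd : p ∣ N
  · have : ¬ (p.Coprime N ∧ p ≠ 0) := fun h => (Nat.Prime.coprime_iff_not_dvd hp).mp h.1 hdvd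
    rw [if_neg this, if_neg (not_not.mpr hdvd), sub_zero]
  · rw [if_pos ⟨(Nat.Prime.coprime_iff_not_dvd hp).mpr hdvd, hp.ne_zero⟩, if_pos hdvd,
      Nat.totient_prime hp, Nat.cast_sub hp.one_le, Nat.cast_one, one_div]

/-- `0 ≤ V(z) ≤ 1` for even `N`. [folklore] -/
theorem sieveProduct_mem_Icc {N : ℕ} (hN : Even N) (z : ℝ) :
    0 ≤ sieveProduct N z ∧ sieveProduct N z ≤ 1 := by
  have hf : ∀ p ∈ (Nat.primesBelow ⌈z⌉₊).filter (fun p : ℕ => ¬p ∣ N),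
      0 ≤ 1 - 1 / ((p : ℝ) - 1) ∧ 1 - 1 / ((p : ℝ) - 1) ≤ 1 := fun p hp => by
    rw [Finset.mem_filter] at hp
    have hpp : p.Prime := Nat.prime_of_mem_primesBelow hp.1
    have hp2 : p ≠ 2 := by
      rintro rfl
      exact hp.2 (even_iff_two_dvd.mp hN)
    have h3 : (3 : ℝ) ≤ p := by
      have := hpp.two_le
      exact_mod_cast (show 3 ≤ p by omega)
    constructor
    · rw [sub_nonneg, div_le_one (by linarith)]; linarith
    · have : 0 ≤ 1 / ((p : ℝ) - 1) := div_nonneg zero_le_one (by linarith)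
      linarith
  exact ⟨Finset.prod_nonneg fun p hp => (hf p hp).1,
    Finset.prod_le_one (fun p hp => (hf p hp).1) fun p hp => (hf p hp).2⟩

/-! ### The dimension condition `Ω(1, L₀)` (Nathanson §10.3: (9.33)–(9.34) via Mertens) -/

/-- The absolute constant `L₀ = 54 e^{54/log 2}` of the dimension condition. [folklore] -/
def dimConst : ℝ := 54 * Real.exp (54 / Real.log 2)

/-- For `w ≥ 2`: `2/(max(w,3) - 2) ≤ 4/log w`. [folklore] -/
theorem two_div_max_sub_two_le {w : ℝ} (hw : 2 ≤ w) : 2 / (max w 3 - 2) ≤ 4 / Real.log w := by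
  have hlogw : 0 < Real.log w := Real.log_pos (by linarith)
  have hlog3 : Real.log 3 ≤ 2 := by
    rw [Real.log_le_iff_le_exp (by norm_num)]
    have := Real.add_one_le_exp (2 : ℝ)
    linarith
  rcases le_or_gt 3 w with h3 | h3
  · rw [max_eq_left h3]
    -- `log w ≤ log 3 + (w/3 - 1) ≤ 1 + w/3 ≤ 2w - 4`
    have hlw : Real.log w ≤ 2 * w - 4 := by
      have h1 : Real.log w = Real.log 3 + Real.log (w / 3) := by
        rw [← Real.log_mul (by norm_num) (by positivity)]; congr 1; ring
      have h2 : Real.log (w / 3) ≤ w / 3 - 1 := Real.log_le_sub_one_of_pos (by positivity)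
      linarith
    rw [div_le_div_iff₀ (by linarith) hlogw]
    nlinarith
  · rw [max_eq_right h3.le]
    have hlw : Real.log w ≤ 2 := (Real.log_le_log (by linarith) h3.le).trans hlog3
    rw [div_le_div_iff₀ (by norm_num) hlogw]
    nlinarith

/-- **`Ω(1, L₀)` for the Goldbach density**, uniformly in even `N`: `0 ≤ g(p) < 1` for all primes
(`g(2) = 0` as `2 ∣ N`, `g(p) ≤ 1/(p-1) ≤ 1/2` otherwise), and for `2 ≤ w ≤ z`,
`∏_{w ≤ p < z} (1 - g(p))⁻¹ ≤ ∏_{w ≤ p < z} (1 - 1/p)⁻¹ (1 + 1/(p(p-2))) ≤ (log z/log w) e^{54/log w}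
≤ (log z/log w)(1 + L₀/log w)` (Mertens' product theorem with rate; Nathanson §10.3 verifies the
qualitative (9.34) the same way). [cite: Nathanson1996, §10.3] -/
theorem hasIwaniecDimension_chenGoldbachSeq {N : ℕ} (hN : Even N) :
    HasIwaniecDimension (chenGoldbachSeq N).density 1 dimConst := by
  have h2N : 2 ∣ N := even_iff_two_dvd.mp hN
  -- the value of `g` at a prime
  have hg : ∀ p : ℕ, p.Prime → (chenGoldbachSeq N).density p =
      if p.Coprime N ∧ p ≠ 0 then ((p : ℝ) - 1)⁻¹ else 0 := by
    intro p hp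
    change shiftedPrimesDensity N p = _
    rw [shiftedPrimesDensity_apply, Nat.totient_prime hp, Nat.cast_sub hp.one_le, Nat.cast_one]
  have hp3 : ∀ p : ℕ, p.Prime → p.Coprime N → (3 : ℝ) ≤ p := by
    intro p hp hcop
    have hp2 : p ≠ 2 := by
      rintro rfl
      exact (Nat.Prime.coprime_iff_not_dvd Nat.prime_two).mp hcop h2N
    have := hp.two_le
    exact_mod_cast (show 3 ≤ p by omega)
  -- factorwise comparison with `(1 - 1/p)⁻¹ (1 + 1/(p(p-2)))`
  have hfac : ∀ p : ℕ, p.Prime →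
      0 ≤ (1 - (chenGoldbachSeq N).density p)⁻¹ ∧
      (1 - (chenGoldbachSeq N).density p)⁻¹ ≤
        (1 - (p : ℝ)⁻¹)⁻¹ * (1 + 1 / ((p : ℝ) * ((p : ℝ) - 2))) := by
    intro p hp
    rw [hg p hp]
    have hp2 : (2 : ℝ) ≤ p := by exact_mod_cast hp.two_le
    have hA : 1 ≤ (1 - (p : ℝ)⁻¹)⁻¹ := by
      rw [one_le_inv_iff₀]
      constructor
      · have : (p : ℝ)⁻¹ ≤ 1 / 2 := by rw [inv_eq_one_div]; gcongr
        linarith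
      · have : 0 < (p : ℝ)⁻¹ := by positivity
        linarith
    have hB : 1 ≤ 1 + 1 / ((p : ℝ) * ((p : ℝ) - 2)) := by
      have : 0 ≤ 1 / ((p : ℝ) * ((p : ℝ) - 2)) := div_nonneg zero_le_one (by nlinarith)
      linarith
    split_ifs with hc
    · have h3 := hp3 p hp hc.1
      have h0 : (p : ℝ) ≠ 0 := by positivity
      have h1 : (p : ℝ) - 1 ≠ 0 := by linarith
      have h2 : (p : ℝ) - 2 ≠ 0 := by linarith
      have hL : 1 - ((p : ℝ) - 1)⁻¹ = ((p : ℝ) - 2) / ((p : ℝ) - 1) := by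
        rw [eq_div_iff h1, sub_mul, inv_mul_cancel₀ h1]; ring
      have hR1 : 1 - (p : ℝ)⁻¹ = ((p : ℝ) - 1) / p := by
        rw [eq_div_iff h0, sub_mul, inv_mul_cancel₀ h0]; ring
      have hR2 : 1 + 1 / ((p : ℝ) * ((p : ℝ) - 2)) = ((p : ℝ) - 1) ^ 2 / ((p : ℝ) * ((p : ℝ) - 2)) := by
        rw [eq_div_iff (mul_ne_zero h0 h2), add_mul, one_div, inv_mul_cancel₀ (mul_ne_zero h0 h2)]
        ring
      have key : (1 - ((p : ℝ) - 1)⁻¹)⁻¹ = (1 - (p : ℝ)⁻¹)⁻¹ * (1 + 1 / ((p : ℝ) * ((p : ℝ) - 2))) := by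
        rw [hL, hR1, hR2, inv_div, inv_div, div_mul_div_comm,
          div_eq_div_iff h2 (mul_ne_zero h1 (mul_ne_zero h0 h2))]
        ring
      refine ⟨?_, key.le⟩
      rw [inv_nonneg, sub_nonneg]
      exact inv_le_one_of_one_le₀ (by linarith)
    · rw [sub_zero, inv_one]
      exact ⟨zero_le_one, by nlinarith⟩
  refine ⟨fun p hp => ?_, fun w z hw hwz => ?_⟩
  · rw [hg p hp]
    split_ifs with hc
    · have h3 := hp3 p hp hc.1
      exact ⟨inv_nonneg.mpr (by linarith), inv_lt_one_of_one_lt₀ (by linarith)⟩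
    · exact ⟨le_rfl, one_pos⟩
  -- the product
  have hlogw : 0 < Real.log w := Real.log_pos (by linarith)
  have hlogz : 0 < Real.log z := Real.log_pos (by linarith)
  have hlog2 : 0 < Real.log 2 := Real.log_pos one_lt_two
  have hlog2w : Real.log 2 ≤ Real.log w := Real.log_le_log two_pos hw
  set S := (Nat.primesBelow ⌈z⌉₊).filter (fun p : ℕ => w ≤ (p : ℝ)) with hS
  have hmemS : ∀ p ∈ S, p.Prime := fun p hp => Nat.prime_of_mem_primesBelow (Finset.mem_filter.mp hp).1
  -- step 1: factorwise
  have h1 : ∏ p ∈ S, (1 - (chenGoldbachSeq N).density p)⁻¹ ≤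
      (∏ p ∈ S, (1 - (p : ℝ)⁻¹)⁻¹) * ∏ p ∈ S, (1 + 1 / ((p : ℝ) * ((p : ℝ) - 2))) := by
    rw [← Finset.prod_mul_distrib]
    exact Finset.prod_le_prod (fun p hp => (hfac p (hmemS p hp)).1) fun p hp => (hfac p (hmemS p hp)).2
  -- step 2: Mertens with rate, `Π(z)/Π(w) ≤ (log z/log w) e^{50/log w}`
  have h2 : ∏ p ∈ S, (1 - (p : ℝ)⁻¹)⁻¹ ≤ Real.log z / Real.log w * Real.exp (50 / Real.log w) := by
    rw [hS, PairProducts.prod_filter_eq_mertensProd_div hwz]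
    set R := PairProducts.mertensProd z / PairProducts.mertensProd w with hR
    have hRpos : 0 < R := div_pos (PairProducts.mertensProd_pos z) (PairProducts.mertensProd_pos w)
    obtain ⟨-, hz2⟩ := abs_le.mp (PairProducts.abs_log_mertensProd_sub_le (le_trans hw hwz))
    obtain ⟨hw1, -⟩ := abs_le.mp (PairProducts.abs_log_mertensProd_sub_le hw)
    have hlogR : Real.log R ≤ Real.log (Real.log z) - Real.log (Real.log w) + 50 / Real.log w := by
      rw [hR, Real.log_div (PairProducts.mertensProd_pos z).ne' (PairProducts.mertensProd_pos w).ne']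
      have : 25 / Real.log z ≤ 25 / Real.log w :=
        div_le_div_of_nonneg_left (by norm_num) hlogw (Real.log_le_log (by linarith) hwz)
      have e50 : (50 : ℝ) / Real.log w = 2 * (25 / Real.log w) := by ring
      linarith
    calc R = Real.exp (Real.log R) := (Real.exp_log hRpos).symm
      _ ≤ Real.exp (Real.log (Real.log z) - Real.log (Real.log w) + 50 / Real.log w) :=
          Real.exp_le_exp.mpr hlogR
      _ = Real.log z / Real.log w * Real.exp (50 / Real.log w) := by
          rw [Real.exp_add, Real.exp_sub, Real.exp_log hlogz, Real.exp_log hlogw]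
  -- step 3: the convergent product, `≤ e^{4/log w}`
  have h3 : ∏ p ∈ S, (1 + 1 / ((p : ℝ) * ((p : ℝ) - 2))) ≤ Real.exp (4 / Real.log w) := by
    set u := max w 3 with hu
    have hu3 : 3 ≤ u := le_max_right _ _
    set S' := (Nat.primesBelow ⌈z⌉₊).filter (fun p : ℕ => u ≤ (p : ℝ)) with hS'
    have hsub : S' ⊆ S := fun p hp => by
      rw [hS', Finset.mem_filter] at hp
      rw [hS, Finset.mem_filter]
      exact ⟨hp.1, (le_max_left w 3).trans hp.2⟩
    have heq : ∏ p ∈ S', (1 + 1 / ((p : ℝ) * ((p : ℝ) - 2))) =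
        ∏ p ∈ S, (1 + 1 / ((p : ℝ) * ((p : ℝ) - 2))) := by
      refine Finset.prod_subset hsub fun p hpS hpS' => ?_
      -- `p ∈ S ∖ S'` forces `p = 2`, where the factor is `1 + 1/(2·0) = 1`
      have hp := hmemS p hpS
      have hpu : (p : ℝ) < u := by
        by_contra hcon
        exact hpS' (by rw [hS', Finset.mem_filter]; exact ⟨(Finset.mem_filter.mp hpS).1, not_lt.mp hcon⟩)
      have hp2 : p = 2 := by
        have hpw : w ≤ (p : ℝ) := (Finset.mem_filter.mp hpS).2
        have hlt3 : (p : ℝ) < 3 := by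
          rcases le_or_gt 3 w with h | h
          · rw [hu, max_eq_left h] at hpu; linarith
          · rw [hu, max_eq_right h.le] at hpu; exact hpu
        have : p < 3 := by exact_mod_cast hlt3
        have := hp.two_le
        omega
      subst hp2
      norm_num
    rw [← heq]
    refine (prod_one_add_inv_mul_sub_two_le (z := z) hu3).trans ?_
    exact Real.exp_le_exp.mpr (two_div_max_sub_two_le hw)
  -- step 4: assemble, `e^{54/log w} ≤ 1 + L₀/log w`
  have h23 : (∏ p ∈ S, (1 - (p : ℝ)⁻¹)⁻¹) * ∏ p ∈ S, (1 + 1 / ((p : ℝ) * ((p : ℝ) - 2))) ≤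
      Real.log z / Real.log w * Real.exp (54 / Real.log w) := by
    have hA0 : 0 ≤ ∏ p ∈ S, (1 + 1 / ((p : ℝ) * ((p : ℝ) - 2))) :=
      Finset.prod_nonneg fun p hp => by
        have hp2 : (2 : ℝ) ≤ p := by exact_mod_cast (hmemS p hp).two_le
        have : 0 ≤ 1 / ((p : ℝ) * ((p : ℝ) - 2)) := div_nonneg zero_le_one (by nlinarith)
        linarith
    calc (∏ p ∈ S, (1 - (p : ℝ)⁻¹)⁻¹) * ∏ p ∈ S, (1 + 1 / ((p : ℝ) * ((p : ℝ) - 2)))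
        ≤ (Real.log z / Real.log w * Real.exp (50 / Real.log w)) * Real.exp (4 / Real.log w) :=
          mul_le_mul h2 h3 hA0 (by positivity)
      _ = Real.log z / Real.log w * Real.exp (54 / Real.log w) := by
          rw [mul_assoc, ← Real.exp_add]; congr 2; ring
  set t := 54 / Real.log w with ht
  have ht0 : 0 ≤ t := by positivity
  have htle : t ≤ 54 / Real.log 2 := div_le_div_of_nonneg_left (by norm_num) hlog2 hlog2w
  calc ∏ p ∈ S, (1 - (chenGoldbachSeq N).density p)⁻¹
      ≤ Real.log z / Real.log w * Real.exp t := h1.trans h23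
    _ ≤ Real.log z / Real.log w * (1 + t * Real.exp (54 / Real.log 2)) := by
        gcongr
        calc Real.exp t ≤ 1 + t * Real.exp t := PairProducts.exp_le_one_add_mul_exp t
          _ ≤ 1 + t * Real.exp (54 / Real.log 2) := by gcongr
    _ = (Real.log z / Real.log w) ^ (1 : ℝ) * (1 + dimConst / Real.log w) := by
        rw [Real.rpow_one, ht, dimConst]; ring

/-! ### The remainders `r(d) = |A_d| - π(N)/φ(d)` (Nathanson (10.9) and p. 171) -/

/-- `|A_d| = #{(p, n) : p + n = N, p prime, p ∤ N, d ∣ n}`. [cite: Nathanson1996, (10.9)] -/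
theorem congrSum_chenGoldbachSeq (N d : ℕ) :
    (chenGoldbachSeq N).congrSum d N = #{a ∈ antidiagonal N | a.1.Prime ∧ ¬ a.1 ∣ N ∧ d ∣ a.2} := by
  classical
  rw [SieveSequence.congrSum, Nat.floor_natCast]
  exact sum_chenGoldbachWeight_filter N (d ∣ ·)

/-- The residue `N (mod q)` as a unit of `ℤ/qℤ` when `(N, q) = 1` (junk value `1` otherwise).
[folklore] -/
def resUnit (N q : ℕ) : (ZMod q)ˣ :=
  if h : N.Coprime q then ZMod.unitOfCoprime N h else 1

/-- For `(N, q) = 1` the unit `resUnit N q` is the class of `N`. [folklore] -/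
theorem coe_resUnit {N q : ℕ} (h : N.Coprime q) : ((resUnit N q : (ZMod q)ˣ) : ZMod q) = N := by
  rw [resUnit, dif_pos h, ZMod.coe_unitOfCoprime]

/-- `δ(N; q, a) = π(N; q, a) - π(N)/φ(q)` as a count:
`primeCountingDisc q a N = #{p ≤ N prime : p ≡ a (q)} - π(N)/φ(q)`. [folklore] -/
theorem primeCountingDisc_eq_card_sub (q : ℕ) (a : ZMod q) (N : ℕ) :
    primeCountingDisc q a N =
      #{p ∈ range (N + 1) | p.Prime ∧ ((p : ℕ) : ZMod q) = a} - (Nat.primeCounting N : ℝ) / Nat.totient q := by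
  classical
  have h1 : (#{p ∈ range (N + 1) | p.Prime ∧ ((p : ℕ) : ZMod q) = a} : ℝ) =
      ∑ n ∈ range (N + 1), if n.Prime then apIndicator q a n else 0 := by
    rw [Finset.natCast_card_filter]
    refine Finset.sum_congr rfl fun n _ => ?_
    by_cases hp : n.Prime <;> simp [hp, apIndicator]
  have h2 : (Nat.primeCounting N : ℝ) = ∑ n ∈ range (N + 1), if n.Prime then (1 : ℝ) else 0 := by
    rw [← Nat.primesLE_card_eq_primeCounting, Nat.primesLE_eq_filter_range, Finset.natCast_card_filter]
  rw [h1, h2, primeCountingDisc, Finset.sum_div, ← Finset.sum_sub_distrib]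
  refine Finset.sum_congr rfl fun n _ => ?_
  split_ifs <;> ring

/-- `ω(N) ≤ log N/log 2` (`2^{ω(N)} ≤ ∏_{p ∣ N} p ≤ N`). [folklore] -/
theorem card_primeFactors_le_log_div {N : ℕ} (hN : N ≠ 0) :
    (N.primeFactors.card : ℝ) ≤ Real.log N / Real.log 2 := by
  have h2 : 2 ^ N.primeFactors.card ≤ N := by
    calc 2 ^ N.primeFactors.card = ∏ _p ∈ N.primeFactors, 2 := by rw [Finset.prod_const]
      _ ≤ ∏ p ∈ N.primeFactors, p :=
          Finset.prod_le_prod' fun p hp => (Nat.prime_of_mem_primeFactors hp).two_le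
      _ ≤ N := Nat.le_of_dvd (Nat.pos_of_ne_zero hN) (Nat.prod_primeFactors_dvd N)
  have hlog2 : 0 < Real.log 2 := Real.log_pos one_lt_two
  rw [le_div_iff₀ hlog2, ← Real.log_pow]
  refine Real.log_le_log (by positivity) ?_
  exact_mod_cast h2

/-- **The remainder of the Goldbach sequence** (Nathanson p. 171: `r(d) = δ(N; d, N) + O(log N)`):
for `d ≠ 0`, `|r(d)| ≤ |δ(N; d, N)| + ω(N)`; more precisely, for `(d, N) = 1`,
`|A_d| = π(N; d, N) - #{p ∣ N : p ≡ N (d)}`, and for `(d, N) > 1` both `|A_d|` and `g(d)` vanish.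
[cite: Nathanson1996, §10.4 (proof of Thm 10.4)] -/
theorem abs_remainder_chenGoldbachSeq_le {N : ℕ} (hN : N ≠ 0) {d : ℕ} (hd : d ≠ 0) :
    |(chenGoldbachSeq N).remainder d N| ≤
      |primeCountingDisc d (resUnit N d : ZMod d) N| + N.primeFactors.card := by
  classical
  rw [SieveSequence.remainder, congrSum_chenGoldbachSeq]
  change |(#{a ∈ antidiagonal N | a.1.Prime ∧ ¬ a.1 ∣ N ∧ d ∣ a.2} : ℝ) -
      shiftedPrimesDensity N d * (Nat.primeCounting N : ℝ)| ≤ _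
  rw [shiftedPrimesDensity_apply]
  by_cases hcop : d.Coprime N
  · rw [if_pos ⟨hcop, hd⟩, primeCountingDisc_eq_card_sub, coe_resUnit hcop.symm]
    set C₁ := #{a ∈ antidiagonal N | a.1.Prime ∧ ¬ a.1 ∣ N ∧ d ∣ a.2} with hC₁
    set C₂ := #{p ∈ range (N + 1) | p.Prime ∧ ((p : ℕ) : ZMod d) = N} with hC₂
    -- `C₁ ≤ C₂`: `(p, n) ↦ p` is injective and `p ≡ N (d)` as `d ∣ n`
    have h12 : C₁ ≤ C₂ := by
      refine Finset.card_le_card_of_injOn Prod.fst (fun a ha => ?_) ?_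
      · rw [Finset.mem_coe, Finset.mem_filter, HasAntidiagonal.mem_antidiagonal] at ha
        obtain ⟨hsum, hp, -, hdvd⟩ := ha
        rw [Finset.mem_coe, Finset.mem_filter, Finset.mem_range]
        refine ⟨by omega, hp, ?_⟩
        have h : ((a.1 + a.2 : ℕ) : ZMod d) = N := by rw [hsum]
        rwa [Nat.cast_add, (ZMod.natCast_eq_zero_iff _ _).mpr hdvd, add_zero] at h
      · intro a ha b hb hab
        simp only [Finset.mem_coe, Finset.mem_filter, HasAntidiagonal.mem_antidiagonal] at ha hb
        refine Prod.ext hab ?_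
        have h1 := ha.1
        have h2 := hb.1
        change a.1 = b.1 at hab
        omega
    -- `C₂ ≤ C₁ + ω(N)`: a prime `p ≡ N (d)`, `p ≤ N`, either divides `N` or gives `(p, N - p)`
    have h21 : C₂ ≤ C₁ + N.primeFactors.card := by
      have hsub : (range (N + 1)).filter (fun p => p.Prime ∧ ((p : ℕ) : ZMod d) = N) ⊆
          ((antidiagonal N).filter (fun a : ℕ × ℕ => a.1.Prime ∧ ¬ a.1 ∣ N ∧ d ∣ a.2)).image
              Prod.fst ∪ N.primeFactors := by
        intro p hp
        rw [Finset.mem_filter, Finset.mem_range] at hp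
        obtain ⟨hpN, hpp, hres⟩ := hp
        rw [Finset.mem_union]
        by_cases hpdvd : p ∣ N
        · exact Or.inr (Nat.mem_primeFactors.mpr ⟨hpp, hpdvd, hN⟩)
        · refine Or.inl (Finset.mem_image.mpr ⟨(p, N - p), ?_, rfl⟩)
          rw [Finset.mem_filter, HasAntidiagonal.mem_antidiagonal]
          refine ⟨by dsimp only; omega, hpp, hpdvd, ?_⟩
          have hmod : p % d = N % d := (ZMod.natCast_eq_natCast_iff' p N d).mp hres
          exact (Nat.modEq_iff_dvd' (by omega)).mp hmod
      calc C₂ ≤ #(((antidiagonal N).filter (fun a : ℕ × ℕ => a.1.Prime ∧ ¬ a.1 ∣ N ∧ d ∣ a.2)).image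
              Prod.fst ∪ N.primeFactors) := Finset.card_le_card hsub
        _ ≤ #(((antidiagonal N).filter (fun a : ℕ × ℕ => a.1.Prime ∧ ¬ a.1 ∣ N ∧ d ∣ a.2)).image
              Prod.fst) + N.primeFactors.card := Finset.card_union_le _ _
        _ ≤ C₁ + N.primeFactors.card := Nat.add_le_add_right Finset.card_image_le _
    have h12' : (C₁ : ℝ) ≤ C₂ := by exact_mod_cast h12
    have h21' : (C₂ : ℝ) ≤ C₁ + N.primeFactors.card := by exact_mod_cast h21
    have hdiff : |(C₁ : ℝ) - C₂| ≤ N.primeFactors.card := abs_sub_le_iff.mpr ⟨by linarith, by linarith⟩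
    have e : (C₁ : ℝ) - ((Nat.totient d : ℝ))⁻¹ * (Nat.primeCounting N : ℝ) =
        ((C₂ : ℝ) - (Nat.primeCounting N : ℝ) / Nat.totient d) + ((C₁ : ℝ) - C₂) := by
      rw [div_eq_mul_inv]; ring
    rw [e]
    exact (abs_add_le _ _).trans (by linarith)
  · -- `(d, N) > 1`: a common prime factor `q` of `d` and `N` cannot divide `n = N - p`
    have hne : Nat.gcd d N ≠ 1 := hcop
    obtain ⟨q, hq, hqg⟩ := Nat.exists_prime_and_dvd hne
    have hqd : q ∣ d := hqg.trans (Nat.gcd_dvd_left d N)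
    have hqN : q ∣ N := hqg.trans (Nat.gcd_dvd_right d N)
    have hempty : (antidiagonal N).filter (fun a : ℕ × ℕ => a.1.Prime ∧ ¬ a.1 ∣ N ∧ d ∣ a.2) = ∅ := by
      refine Finset.filter_eq_empty_iff.mpr fun a ha h => ?_
      rw [HasAntidiagonal.mem_antidiagonal] at ha
      obtain ⟨hp, hndvd, hdvd⟩ := h
      have hqa1 : q ∣ a.1 := by
        have : q ∣ a.1 + a.2 := by rw [ha]; exact hqN
        exact (Nat.dvd_add_left (hqd.trans hdvd)).mp this
      exact hndvd (((Nat.prime_dvd_prime_iff_eq hq hp).mp hqa1) ▸ hqN)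
    rw [hempty, if_neg fun h => hcop h.1, Finset.card_empty, Nat.cast_zero, zero_mul, sub_zero,
      abs_zero]
    positivity

/-- **The remainder sum is dominated by the Bombieri–Vinogradov sum** (Nathanson p. 172:
`R ≤ ∑_{d<QD,(d,N)=1} |δ(N; d, N)| + QD log N`): for `D ≥ 0`,
`∑_{d < D, d ∣ P(z)} |r(d)| ≤ ∑_{d ≤ D} |δ(N; d, a_d)| + D ω(N)` with `a_d = N (mod d)`.
[cite: Nathanson1996, §10.4 (proof of Thm 10.4)] -/
theorem remainderSum_chenGoldbachSeq_le {N : ℕ} (hN : N ≠ 0) (z : ℝ) {D : ℝ} (hD : 0 ≤ D) :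
    ∑ d ∈ (Finset.range ⌈D⌉₊).filter (· ∣ primesProdBelow z), |(chenGoldbachSeq N).remainder d N| ≤
      (∑ d ∈ Icc 1 ⌊D⌋₊, |primeCountingDisc d (resUnit N d : ZMod d) N|) +
        D * N.primeFactors.card := by
  have hsub : (Finset.range ⌈D⌉₊).filter (· ∣ primesProdBelow z) ⊆ Icc 1 ⌊D⌋₊ := by
    intro d hd
    rw [Finset.mem_filter, Finset.mem_range] at hd
    have hd0 : d ≠ 0 := fun h0 => primesProdBelow_ne_zero z (zero_dvd_iff.mp (h0 ▸ hd.2))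
    rw [Finset.mem_Icc]
    exact ⟨Nat.pos_of_ne_zero hd0, Nat.le_floor (Nat.lt_ceil.mp hd.1).le⟩
  calc ∑ d ∈ (Finset.range ⌈D⌉₊).filter (· ∣ primesProdBelow z), |(chenGoldbachSeq N).remainder d N|
      ≤ ∑ d ∈ (Finset.range ⌈D⌉₊).filter (· ∣ primesProdBelow z),
          (|primeCountingDisc d (resUnit N d : ZMod d) N| + N.primeFactors.card) := by
        refine Finset.sum_le_sum fun d hd => ?_
        rw [Finset.mem_filter] at hd
        have hd0 : d ≠ 0 := fun h0 => primesProdBelow_ne_zero z (zero_dvd_iff.mp (h0 ▸ hd.2))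
        exact abs_remainder_chenGoldbachSeq_le hN hd0
    _ ≤ ∑ d ∈ Icc 1 ⌊D⌋₊, (|primeCountingDisc d (resUnit N d : ZMod d) N| + N.primeFactors.card) :=
        Finset.sum_le_sum_of_subset_of_nonneg hsub fun d _ _ => by positivity
    _ = (∑ d ∈ Icc 1 ⌊D⌋₊, |primeCountingDisc d (resUnit N d : ZMod d) N|) +
          ⌊D⌋₊ * N.primeFactors.card := by
        rw [Finset.sum_add_distrib, Finset.sum_const, Nat.card_Icc, Nat.add_sub_cancel, nsmul_eq_mul]
    _ ≤ _ := by gcongr; exact Nat.floor_le hD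

/-! ### Assembly: Theorem 10.4 -/

set_option maxHeartbeats 800000 in
/-- **Nathanson's Theorem 10.4, PROVED** (discharge of `chen_sifted_lower`): for every `ε > 0` and
all large even `N`, `S(A, 𝒫, z) > (e^γ log 3/2 - ε) N V(z)/log N` (`z = N^{1/8}`). Proof: the linear
sieve lower bound (Iwaniec's Theorem 1 at `κ = 1`, uniform in the sequence, with
`f(s) = 2e^γ log(s-1)/s` on `[2, 4]`) for `chenGoldbachSeq N` at level `D = N^{1/2-δ}`
(`s = 4 - 8δ`, `f(s) ≥ e^γ log 3/2 - O(ε)`), the remainder controlled by Bombieri–Vinogradov in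
`π`-form (`R ≤ C N/(log N)⁴ + N^{1/2-δ} ω(N) = o(N V(z)/log N)` as `V(z) ≫ 1/log N`), and
`X = π(N) ≥ (1 - η) N/log N` (prime number theorem). [cite: Nathanson1996, Thm 10.4] -/
theorem chen_sifted_lower_holds : chen_sifted_lower := by
  intro ε hε
  -- constants
  set G := Real.exp Real.eulerMascheroniConstant with hG
  have hG0 : 0 < G := Real.exp_pos _
  have hlog3 : 1 < Real.log 3 := by
    rw [Real.lt_log_iff_exp_lt (by norm_num)]
    exact Real.exp_one_lt_d9.trans (by norm_num)
  set a := G * Real.log 3 / 2 with ha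
  have ha0 : 0 < a := by positivity
  -- the working accuracy `ε' = min ε (a/2)`
  set ε' := min ε (a / 2) with hε'
  have hε'0 : 0 < ε' := lt_min hε (by positivity)
  have hε'ε : ε' ≤ ε := min_le_left _ _
  have hε'a : ε' ≤ a / 2 := min_le_right _ _
  -- parameters: level `N^{1/2 - δ}`, PNT accuracy `η`
  set δ := min (1 / 16) (ε' / (16 * G)) with hδ
  have hδ0 : 0 < δ := by positivity
  have hδ1 : δ ≤ 1 / 16 := min_le_left _ _
  have hδ2 : δ ≤ ε' / (16 * G) := min_le_right _ _
  set θ₁ := 1 / 2 - δ with hθ₁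
  have hθ₁lt : θ₁ < 1 / 2 := by rw [hθ₁]; linarith
  have hθ₁pos : 0 < θ₁ := by rw [hθ₁]; linarith
  set η := ε' / (16 * a) with hη
  have hη0 : 0 < η := by positivity
  -- the linear sieve (Iwaniec's Theorem 1, `κ = 1`) and its constant for `Ω(1, L₀)`
  obtain ⟨B, hB, hBC⟩ := Iwaniec1980_thm1_lower_of_half_lt (κ := 1) (by norm_num)
  obtain ⟨C, hC⟩ := hBC dimConst
  have hfeq : Set.EqOn B.2.1 (iwaniecLowerSieveFun 1) (Set.Ioi 0) := hB.eqOn_iwaniecSieveFun.2.1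
  -- Bombieri–Vinogradov (`π`-form, level `N^{θ₁}`)
  obtain ⟨C₁, hC₁⟩ := eventually_sum_abs_primeCountingDisc_le BombieriVinogradovStatement_holds
    hθ₁lt (A := 4) (by norm_num)
  -- the constant of `V(z)⁻¹ ≤ κ₀ log N`
  have hlog2 : 0 < Real.log 2 := Real.log_pos one_lt_two
  have hdim0 : 0 ≤ dimConst := by rw [dimConst]; positivity
  set κ₀ := (1 + dimConst / Real.log 2) / (8 * Real.log 2) with hκ₀
  have hκ₀0 : 0 < κ₀ := by positivity
  -- eventualities
  have hE1 := eventually_primeCounting_bounds hη0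
  have hE2 : ∀ᶠ N : ℕ in atTop, max C 0 * (θ₁ * Real.log N) ^ (-(1 / 3 : ℝ)) ≤ ε' / 16 := by
    have ht : Tendsto (fun x : ℝ => max C 0 * (θ₁ * Real.log x) ^ (-(1 / 3 : ℝ))) atTop
        (𝓝 (max C 0 * 0)) :=
      ((tendsto_rpow_neg_atTop (by norm_num : (0 : ℝ) < 1 / 3)).comp
        (Real.tendsto_log_atTop.const_mul_atTop hθ₁pos)).const_mul _
    rw [mul_zero] at ht
    exact tendsto_natCast_atTop_atTop.eventually (ht.eventually_le_const (by positivity))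
  have hE3 : ∀ᶠ N : ℕ in atTop, 16 * κ₀ * max C₁ 0 ≤ ε' * Real.log N ^ 2 := by
    have ht : Tendsto (fun x : ℝ => ε' * Real.log x ^ 2) atTop atTop :=
      ((tendsto_pow_atTop two_ne_zero).comp Real.tendsto_log_atTop).const_mul_atTop hε'0
    exact tendsto_natCast_atTop_atTop.eventually (ht.eventually_ge_atTop _)
  have hE4 : ∀ᶠ N : ℕ in atTop,
      Real.log (N : ℝ) ^ 3 ≤ ε' * Real.log 2 / (16 * κ₀) * (N : ℝ) ^ (1 - θ₁) := by
    have hlo := (isLittleO_log_rpow_rpow_atTop 3 (show (0 : ℝ) < 1 - θ₁ by linarith)).def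
      (show 0 < ε' * Real.log 2 / (16 * κ₀) by positivity)
    filter_upwards [tendsto_natCast_atTop_atTop.eventually hlo, eventually_ge_atTop 1] with N hN hN1
    have hN0 : (0 : ℝ) ≤ N := Nat.cast_nonneg N
    rw [Real.norm_of_nonneg (by positivity), Real.norm_of_nonneg (Real.rpow_nonneg hN0 _)] at hN
    have e3 : Real.log (N : ℝ) ^ (3 : ℝ) = Real.log N ^ 3 := by
      rw [show (3 : ℝ) = ((3 : ℕ) : ℝ) by norm_num, Real.rpow_natCast]
    rwa [e3] at hN
  obtain ⟨N₀, hN₀⟩ := Filter.eventually_atTop.mp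
    ((eventually_ge_atTop 256).and (hE1.and (hC₁.and (hE2.and (hE3.and hE4)))))
  refine ⟨N₀, fun N hN hEven => ?_⟩
  obtain ⟨h256, hPNT, hBVN, h2, h3, h4⟩ := hN₀ N hN
  -- basic facts about `N`
  have hN0 : N ≠ 0 := by omega
  have hN1 : (1 : ℝ) < N := by exact_mod_cast (show 1 < N by omega)
  have hNpos : (0 : ℝ) < N := by linarith
  have hN256 : (256 : ℝ) ≤ N := by exact_mod_cast h256
  set L := Real.log N with hL
  have hL0 : 0 < L := Real.log_pos hN1
  have hL1 : 1 ≤ L := by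
    rw [hL, ← Real.log_exp 1]
    exact Real.log_le_log (Real.exp_pos 1) (by linarith [Real.exp_one_lt_d9])
  -- the sieve parameters `z = N^{1/8}`, `D = N^{1/2 - δ}`, `s = log D/log z = 4 - 8δ`
  set zN := (N : ℝ) ^ (1 / 8 : ℝ) with hzN
  set D := (N : ℝ) ^ θ₁ with hD
  have hz2 : 2 ≤ zN := by
    rw [hzN, show (2 : ℝ) = ((2 : ℝ) ^ (8 : ℕ)) ^ (1 / 8 : ℝ) by
      rw [← Real.rpow_natCast, ← Real.rpow_mul (by norm_num)]; norm_num]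
    exact Real.rpow_le_rpow (by norm_num) (by norm_num; exact_mod_cast h256) (by norm_num)
  have hlogz : Real.log zN = 1 / 8 * L := by rw [hzN, Real.log_rpow hNpos]
  have hlogD : Real.log D = θ₁ * L := by rw [hD, Real.log_rpow hNpos]
  have hzD : zN ≤ D := by
    rw [hzN, hD]
    exact Real.rpow_le_rpow_of_exponent_le hN1.le (by rw [hθ₁]; linarith)
  have hD0 : 0 ≤ D := Real.rpow_nonneg hNpos.le _
  have hs : Real.log D / Real.log zN = 4 - 8 * δ := by
    rw [hlogz, hlogD, hθ₁]; field_simp; ring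
  -- the sieve theorem for `chenGoldbachSeq N` at `x = N`, `y = D`, `z = N^{1/8}`
  have hdim := hasIwaniecDimension_chenGoldbachSeq hEven
  have hmain := hC (chenGoldbachSeq N) hdim N D zN hz2 hzD
    (show (0 : ℝ) ≤ (Nat.primeCounting N : ℝ) from Nat.cast_nonneg _)
  have hsize : (chenGoldbachSeq N).size N = (Nat.primeCounting N : ℝ) := rfl
  -- the value `f(4 - 8δ) = 2e^γ log(3 - 8δ)/(4 - 8δ)`
  have hfval : B.2.1 (4 - 8 * δ) = 2 * G * Real.log (4 - 8 * δ - 1) / (4 - 8 * δ) := by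
    rw [hfeq (show (0 : ℝ) < 4 - 8 * δ by linarith), ← lowerSieveFun_one]
    have hle : ∀ {s : ℝ}, s ∈ Set.Icc (2 : ℝ) 4 → lowerSieveFun 1 s =
        2 * Real.exp Real.eulerMascheroniConstant * Real.log (s - 1) / s :=
      lowerSieveFun_one_eq_holds
    rw [hle ⟨by linarith, by linarith⟩]
  rw [sifted_chenGoldbachSeq, densityProduct_chenGoldbachSeq, hs, hsize, hfval] at hmain
  -- names (introduced now, so that they are substituted into `hmain` and `hPNT`)
  set V := sieveProduct N zN with hV
  set X := (Nat.primeCounting N : ℝ) with hX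
  set R := ∑ d ∈ (range ⌈D⌉₊).filter (· ∣ primesProdBelow zN), |(chenGoldbachSeq N).remainder d N|
    with hR
  set S := (siftedCount N zN : ℝ) with hS
  set M := (N : ℝ) * V / L with hM
  have hVI : 0 ≤ V ∧ V ≤ 1 := sieveProduct_mem_Icc hEven zN
  -- (0) `V ≥ 1/(κ₀ L)`, hence `M ≥ N/(κ₀ L²) > 0`
  have hVpos : 0 < V := by
    rw [hV, ← densityProduct_chenGoldbachSeq]; exact hdim.densityProduct_pos zN
  have hVinv : V⁻¹ ≤ κ₀ * L := by
    have h := hdim.inv_densityProduct_le hz2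
    rw [densityProduct_chenGoldbachSeq, Real.rpow_one, hlogz] at h
    refine h.trans (le_of_eq ?_)
    rw [hκ₀]; field_simp
  have hMpos : 0 < M := by positivity
  have hKM : (N : ℝ) / (κ₀ * L ^ 2) ≤ M := by
    have h1 : (κ₀ * L)⁻¹ ≤ V := by rw [inv_le_comm₀ (by positivity) hVpos]; exact hVinv
    calc (N : ℝ) / (κ₀ * L ^ 2) = (N : ℝ) / L * (κ₀ * L)⁻¹ := by field_simp
      _ ≤ (N : ℝ) / L * V := mul_le_mul_of_nonneg_left h1 (by positivity)
      _ = M := by rw [hM]; ring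
  -- (1) the coefficient: `f(s) - C (log D)^{-1/3} ≥ a - ε'/4`
  have hcoef := sieveLowerConst_ge (εJ := 0) hε'0 hδ0 hδ1 hδ2 (by positivity)
  rw [← hG, ← ha, zero_mul, sub_zero] at hcoef
  have herr1 : C * Real.log D ^ (-(1 / 3 : ℝ)) ≤ ε' / 16 := by
    rw [hlogD]
    refine le_trans ?_ h2
    exact mul_le_mul_of_nonneg_right (le_max_left _ _) (Real.rpow_nonneg (by positivity) _)
  have hc : a - ε' / 4 ≤
      2 * G * Real.log (4 - 8 * δ - 1) / (4 - 8 * δ) - C * Real.log D ^ (-(1 / 3 : ℝ)) := by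
    linarith
  have hc0 : 0 ≤ a - ε' / 4 := by linarith
  -- (2) the main term: `X V (f - Cℓ) ≥ (a - 5ε'/16) M` (PNT: `X ≥ (1 - η) N/L`, `η a = ε'/16`)
  have hXlow : (1 - η) * ((N : ℝ) / L) ≤ X := hPNT.1
  have hmainTerm : (a - 5 * ε' / 16) * M ≤
      X * V * (2 * G * Real.log (4 - 8 * δ - 1) / (4 - 8 * δ) - C * Real.log D ^ (-(1 / 3 : ℝ))) := by
    have hηa : η * a = ε' / 16 := by rw [hη]; field_simp
    have hη1 : 0 ≤ 1 - η := by
      rw [sub_nonneg]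
      have : η * a ≤ 1 * a := by rw [hηa, one_mul]; linarith
      exact le_of_mul_le_mul_right this ha0
    calc (a - 5 * ε' / 16) * M ≤ (1 - η) * (a - ε' / 4) * M := by
          refine mul_le_mul_of_nonneg_right ?_ hMpos.le
          nlinarith [hηa, hη0, hε'0]
      _ = ((1 - η) * ((N : ℝ) / L)) * V * (a - ε' / 4) := by rw [hM]; ring
      _ ≤ X * V * (a - ε' / 4) :=
          mul_le_mul_of_nonneg_right (mul_le_mul_of_nonneg_right hXlow hVI.1) hc0
      _ ≤ _ := mul_le_mul_of_nonneg_left hc (mul_nonneg (Nat.cast_nonneg _) hVI.1)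
  -- (3) the remainder: `R ≤ C₁ N/L⁴ + D L/log 2 ≤ (ε'/8) M`
  have hω : (N.primeFactors.card : ℝ) ≤ L / Real.log 2 := card_primeFactors_le_log_div hN0
  have hRle : R ≤ C₁ * N / L ^ 4 + D * (L / Real.log 2) := by
    refine (remainderSum_chenGoldbachSeq_le hN0 zN hD0).trans ?_
    have hb := hBVN (resUnit N)
    rw [show (4 : ℝ) = ((4 : ℕ) : ℝ) by norm_num, Real.rpow_natCast] at hb
    exact add_le_add hb (mul_le_mul_of_nonneg_left hω hD0)
  have hR1 : C₁ * N / L ^ 4 ≤ ε' / 16 * M := by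
    have h3' : 16 * κ₀ * max C₁ 0 ≤ ε' * L ^ 2 := h3
    calc C₁ * N / L ^ 4 ≤ max C₁ 0 * N / L ^ 4 := by
          rw [mul_div_assoc, mul_div_assoc]
          exact mul_le_mul_of_nonneg_right (le_max_left _ _) (by positivity)
      _ = (16 * κ₀ * max C₁ 0) * (N / (16 * κ₀ * L ^ 4)) := by field_simp
      _ ≤ (ε' * L ^ 2) * (N / (16 * κ₀ * L ^ 4)) := mul_le_mul_of_nonneg_right h3' (by positivity)
      _ = ε' / 16 * (N / (κ₀ * L ^ 2)) := by field_simp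
      _ ≤ ε' / 16 * M := mul_le_mul_of_nonneg_left hKM (by positivity)
  have hR2 : D * (L / Real.log 2) ≤ ε' / 16 * M := by
    have hsplit : (N : ℝ) = D * (N : ℝ) ^ (1 - θ₁) := by
      rw [hD, ← Real.rpow_add hNpos, show θ₁ + (1 - θ₁) = 1 by ring, Real.rpow_one]
    calc D * (L / Real.log 2) = D * L ^ 3 / (Real.log 2 * L ^ 2) := by field_simp
      _ ≤ D * (ε' * Real.log 2 / (16 * κ₀) * (N : ℝ) ^ (1 - θ₁)) / (Real.log 2 * L ^ 2) := by
          gcongr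
      _ = ε' / 16 * ((D * (N : ℝ) ^ (1 - θ₁)) / (κ₀ * L ^ 2)) := by field_simp
      _ = ε' / 16 * (N / (κ₀ * L ^ 2)) := by rw [← hsplit]
      _ ≤ ε' / 16 * M := mul_le_mul_of_nonneg_left hKM (by positivity)
  -- (4) combine: `S ≥ (a - 7ε'/16) M > (a - ε') M ≥ (a - ε) M`
  have hSge : (a - 7 * ε' / 16) * M ≤ S := by
    have e : (a - 7 * ε' / 16) * M = (a - 5 * ε' / 16) * M - (ε' / 16 * M + ε' / 16 * M) := by ring
    linarith [hmain, hmainTerm, hRle, hR1, hR2]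
  show (a - ε) * M < S
  have h5 : (a - ε) * M ≤ (a - ε') * M := mul_le_mul_of_nonneg_right (by linarith) hMpos.le
  have h6 : (a - ε') * M < (a - 7 * ε' / 16) * M := mul_lt_mul_of_pos_right (by linarith) hMpos
  linarith

end Literature.NumberTheory.Sieve.Chen
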